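import Literature.Analysis.FunctionSpaces.TorusCalculusProofs
import Literature.Analysis.FluidPDE.TorusPressurePoisson
import Summits.NavierStokesRegularity.FunctionalMining.VelocityL4Interpolation
import HarnessLib

/-!
# FunctionalMining — the pressure production of `U₄ = ∫|u|⁴`: `4∫ p u·∇|u|² = −4∫|u|² ⟪∇p, u⟫`
# and its bound by `√(∫|u|⁶) √(∫|∇p|²)` (static inputs of K0 row `EV.s=4|T_LD|G1`)

search for candidate a priori estimates; no regularity claim. Cell `pub-nsfunc`, prove seat
(gen 8). Static identities/inequalities for a smooth divergence-free field `u` and a smooth scalar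
`p` on `T^d`; nothing is asserted about Navier–Stokes solutions (the companion file
`VelocityL4SaturatingLaw` feeds the classical `L⁴` balance of the tree,
`Torus.IsClassicalNSSolutionOn.hasDerivWithinAt_integral_normSq_pow`, into these).

* `norm_convect_self_sq_le`, `integral_norm_convect_self_sq_le` — `‖(u·∇)u‖² ≤ ‖u‖² ∑ₖ‖∂ₖu‖²`
  pointwise (Cauchy–Schwarz in `ℝ^d`) and integrated: `∫‖(u·∇)u‖² ≤ I := ∫‖u‖²∑ₖ‖∂ₖu‖²`.
* `sum_partialDeriv_mul_eq_inner_gradient` — `∑ₖ ∂ₖp · wₖ = ⟪∇p, w⟫`.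
* `pressure_term_eq` — for divergence-free `u`: `∫ p ∑ₖ uₖ ∂ₖ|u|² = −∫ |u|² ⟪∇p, u⟫`
  (one integration by parts per `k`, `div u = 0`; RRS 2016 Ex. 11.4's pressure term).
* `abs_pressure_term_le` — `|∫ |u|²⟪∇p, u⟫| ≤ √(∫‖u‖⁶) √(∫‖∇p‖²)` (Cauchy–Schwarz).
[ours; elementary]
-/

noncomputable section

open MeasureTheory Finset
open scoped InnerProductSpace RealInnerProductSpace ContDiff

namespace Summit.NavierStokesRegularity.FunctionalMining

open Literature.Analysis.FunctionSpaces Literature.Analysis.FunctionSpaces.Torus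

namespace VelocityL4

variable {d : Type*} [Fintype d] [DecidableEq d]

/-! ## 1. The convective term by `‖u‖² ∑ₖ‖∂ₖu‖²` -/

/-- `‖(u·∇)u (x)‖² ≤ ‖u x‖² ∑ₖ ‖∂ₖu x‖²` (expansion `Du(x)[u x] = ∑ₖ uₖ ∂ₖu` and Cauchy–Schwarz).
[folklore] -/
theorem norm_convect_self_sq_le {u : UnitAddTorus d → EuclideanSpace ℝ d} (hu : IsSmooth u)
    (x : UnitAddTorus d) :
    ‖convect u u x‖ ^ 2 ≤ ‖u x‖ ^ 2 * ∑ k, ‖partialDeriv k u x‖ ^ 2 := by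
  have hu1 : IsContDiff 1 u := hu.isContDiff (by simp)
  have hexp : convect u u x = ∑ i, u x i • partialDeriv i u x :=
    fderiv_apply_eq_sum_partialDeriv hu1 x (u x)
  have h1 : ‖convect u u x‖ ≤ ∑ i, |u x i| * ‖partialDeriv i u x‖ := by
    rw [hexp]
    calc ‖∑ i, u x i • partialDeriv i u x‖ ≤ ∑ i, ‖u x i • partialDeriv i u x‖ := norm_sum_le _ _
      _ = ∑ i, |u x i| * ‖partialDeriv i u x‖ := by
          refine Finset.sum_congr rfl fun i _ => ?_
          rw [norm_smul, Real.norm_eq_abs]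
  have hCS : (∑ i, |u x i| * ‖partialDeriv i u x‖) ^ 2 ≤
      (∑ i, |u x i| ^ 2) * ∑ i, ‖partialDeriv i u x‖ ^ 2 :=
    Finset.sum_mul_sq_le_sq_mul_sq _ _ _
  have hnorm : ∑ i, |u x i| ^ 2 = ‖u x‖ ^ 2 := by
    rw [EuclideanSpace.norm_sq_eq]
    exact Finset.sum_congr rfl fun i _ => by rw [Real.norm_eq_abs]
  have h0 : 0 ≤ ∑ i, |u x i| * ‖partialDeriv i u x‖ :=
    Finset.sum_nonneg fun i _ => mul_nonneg (abs_nonneg _) (norm_nonneg _)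
  calc ‖convect u u x‖ ^ 2 ≤ (∑ i, |u x i| * ‖partialDeriv i u x‖) ^ 2 :=
        pow_le_pow_left₀ (norm_nonneg _) h1 2
    _ ≤ (∑ i, |u x i| ^ 2) * ∑ i, ‖partialDeriv i u x‖ ^ 2 := hCS
    _ = ‖u x‖ ^ 2 * ∑ k, ‖partialDeriv k u x‖ ^ 2 := by rw [hnorm]

/-- `∫ ‖(u·∇)u‖² ≤ ∫ ‖u‖² ∑ₖ ‖∂ₖu‖²`. [folklore] -/
theorem integral_norm_convect_self_sq_le {u : UnitAddTorus d → EuclideanSpace ℝ d}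
    (hu : IsSmooth u) :
    ∫ x, ‖convect u u x‖ ^ 2 ≤ ∫ x, ‖u x‖ ^ 2 * ∑ k, ‖partialDeriv k u x‖ ^ 2 := by
  have hc1 : Continuous fun x => ‖convect u u x‖ ^ 2 := (hu.convect hu).continuous.norm.pow 2
  have hc2 : Continuous fun x => ‖u x‖ ^ 2 * ∑ k, ‖partialDeriv k u x‖ ^ 2 :=
    (hu.continuous.norm.pow 2).mul
      (continuous_finsetSum _ fun k _ => (hu.partialDeriv k).continuous.norm.pow 2)
  exact integral_mono hc1.integrable_unitAddTorus hc2.integrable_unitAddTorus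
    fun x => norm_convect_self_sq_le hu x

/-! ## 2. The pressure term -/

/-- `∑ₖ ∂ₖp(x) · wₖ = ⟪∇p(x), w⟫`. [folklore] -/
theorem sum_partialDeriv_mul_eq_inner_gradient {p : UnitAddTorus d → ℝ} (hp : IsSmooth p)
    (x : UnitAddTorus d) (w : EuclideanSpace ℝ d) :
    ∑ k, partialDeriv k p x * w k = ⟪gradient p x, w⟫ := by
  rw [Torus.inner_gradient_left, fderiv_apply_eq_sum_partialDeriv (hp.isContDiff (by simp)) x w]
  refine Finset.sum_congr rfl fun k _ => ?_
  rw [smul_eq_mul, mul_comm]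

/-- **The pressure production of `∫|u|⁴`, integrated by parts**: for smooth divergence-free `u`
and smooth `p` on `T^d`,
`∫ p ∑ₖ uₖ ∂ₖ(‖u‖²) = −∫ ‖u‖² ⟪∇p, u⟫`
(`∫ p uₖ ∂ₖ|u|² = −∫ |u|² ∂ₖ(p uₖ)`, `∑ₖ ∂ₖ(p uₖ) = p div u + ⟪∇p, u⟫`, `div u = 0`).
[cite: RobinsonRodrigoSadowski2016, Ch. 11 Exercise 11.4] -/
theorem pressure_term_eq {u : UnitAddTorus d → EuclideanSpace ℝ d} (hu : IsSmooth u)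
    (hdiv : IsDivFree u) {p : UnitAddTorus d → ℝ} (hp : IsSmooth p) :
    ∫ x, p x * ∑ k, u x k * partialDeriv k (fun y => ‖u y‖ ^ 2) x =
      -∫ x, ‖u x‖ ^ 2 * ⟪gradient p x, u x⟫ := by
  set g : UnitAddTorus d → ℝ := fun y => ‖u y‖ ^ 2 with hg
  have hgs : IsSmooth g := hu.norm_sq
  have huk : ∀ k, IsSmooth (fun y => u y k) := fun k => hu.apply k
  have hpk : ∀ k, IsSmooth (fun y => p y * u y k) := fun k => hp.mul (huk k)
  -- per-coordinate integration by parts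
  have hk : ∀ k, ∫ x, p x * (u x k * partialDeriv k g x) =
      -∫ x, g x * (p x * partialDeriv k (fun y => u y k) x + partialDeriv k p x * u x k) := by
    intro k
    have h1 : ∫ x, p x * (u x k * partialDeriv k g x) = ∫ x, partialDeriv k g x * (p x * u x k) :=
      integral_congr_ae (ae_of_all _ fun x => by ring)
    rw [h1, Literature.Analysis.FluidPDE.Torus.integral_partialDeriv_mul_eq_neg_integral hgs (hpk k) k]
    congr 1
    refine integral_congr_ae (ae_of_all _ fun x => ?_)
    dsimp only
    rw [partialDeriv_mul (hp.isContDiff (by simp)) ((huk k).isContDiff (by simp)) k x]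
  -- sum over `k`
  have hint : ∀ k, Integrable (fun x => p x * (u x k * partialDeriv k g x)) volume := fun k =>
    ((hp.continuous.mul ((huk k).continuous.mul (hgs.partialDeriv k).continuous))).integrable_unitAddTorus
  have hL : ∫ x, p x * ∑ k, u x k * partialDeriv k g x =
      ∑ k, ∫ x, p x * (u x k * partialDeriv k g x) := by
    rw [← integral_finsetSum _ fun k _ => hint k]
    exact integral_congr_ae (ae_of_all _ fun x => by simp only [Finset.mul_sum])
  rw [hL]
  simp_rw [hk]
  rw [Finset.sum_neg_distrib]
  congr 1
  have hint2 : ∀ k, Integrable (fun x => g x * (p x * partialDeriv k (fun y => u y k) x +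
      partialDeriv k p x * u x k)) volume := fun k =>
    (hgs.continuous.mul ((hp.continuous.mul ((huk k).partialDeriv k).continuous).add
      ((hp.partialDeriv k).continuous.mul (huk k).continuous))).integrable_unitAddTorus
  rw [← integral_finsetSum _ fun k _ => hint2 k]
  refine integral_congr_ae (ae_of_all _ fun x => ?_)
  have hdx : ∑ k, partialDeriv k (fun y => u y k) x = 0 := hdiv x
  have hgrad := sum_partialDeriv_mul_eq_inner_gradient hp x (u x)
  calc ∑ k, g x * (p x * partialDeriv k (fun y => u y k) x + partialDeriv k p x * u x k)
      = g x * (p x * ∑ k, partialDeriv k (fun y => u y k) x) +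
          g x * ∑ k, partialDeriv k p x * u x k := by
        rw [Finset.mul_sum, Finset.mul_sum, Finset.mul_sum, ← Finset.sum_add_distrib]
        exact Finset.sum_congr rfl fun k _ => by ring
    _ = g x * ⟪gradient p x, u x⟫ := by rw [hdx, hgrad]; ring
    _ = ‖u x‖ ^ 2 * ⟪gradient p x, u x⟫ := by rw [hg]

omit [DecidableEq d] in
/-- **Cauchy–Schwarz for the pressure production**: `|∫ ‖u‖²⟪∇p, u⟫| ≤ √(∫‖u‖⁶) √(∫‖∇p‖²)`.
[folklore] -/
theorem abs_pressure_term_le {u : UnitAddTorus d → EuclideanSpace ℝ d} (hu : IsSmooth u)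
    {p : UnitAddTorus d → ℝ} (hp : IsSmooth p) :
    |∫ x, ‖u x‖ ^ 2 * ⟪gradient p x, u x⟫| ≤
      Real.sqrt (∫ x, ‖u x‖ ^ 6) * Real.sqrt (∫ x, ‖gradient p x‖ ^ 2) := by
  have hcu : Continuous u := hu.continuous
  have hcg : Continuous (gradient p) := hp.gradient.continuous
  have hc3 : Continuous fun x => ‖u x‖ ^ 3 := hcu.norm.pow 3
  have hcn : Continuous fun x => ‖gradient p x‖ := hcg.norm
  have h1 : |∫ x, ‖u x‖ ^ 2 * ⟪gradient p x, u x⟫| ≤ ∫ x, ‖u x‖ ^ 3 * ‖gradient p x‖ := by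
    have hi : Integrable (fun x => ‖u x‖ ^ 3 * ‖gradient p x‖) volume :=
      (hc3.mul hcn).integrable_unitAddTorus
    calc |∫ x, ‖u x‖ ^ 2 * ⟪gradient p x, u x⟫| ≤ ∫ x, |‖u x‖ ^ 2 * ⟪gradient p x, u x⟫| :=
          abs_integral_le_integral_abs
      _ ≤ ∫ x, ‖u x‖ ^ 3 * ‖gradient p x‖ := by
          refine integral_mono_of_nonneg (ae_of_all _ fun x => abs_nonneg _) hi
            (ae_of_all _ fun x => ?_)
          dsimp only
          rw [abs_mul, abs_of_nonneg (by positivity)]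
          have hcs := abs_real_inner_le_norm (gradient p x) (u x)
          calc ‖u x‖ ^ 2 * |⟪gradient p x, u x⟫| ≤ ‖u x‖ ^ 2 * (‖gradient p x‖ * ‖u x‖) :=
                mul_le_mul_of_nonneg_left hcs (by positivity)
            _ = ‖u x‖ ^ 3 * ‖gradient p x‖ := by ring
  have h2 := integral_mul_le_sqrt_mul_sqrt hc3 hcn
  have e : ∫ x, (‖u x‖ ^ 3) ^ 2 = ∫ x, ‖u x‖ ^ 6 :=
    integral_congr_ae (ae_of_all _ fun x => by ring)
  rw [e] at h2
  exact h1.trans h2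

end VelocityL4

end Summit.NavierStokesRegularity.FunctionalMining
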